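import Summits.QuantumFields.YangMills.Theorems.PoincareLipschitzGapOfHSystemQuantization
import Summits.QuantumFields.YangMills.Theorems.PoincareLipschitzPlanarStreamFunctionBundle
import HarnessLib

/-!
# Crux `BlockLipschitzL` (stmt-QuantumFields-23533) ∕ `HistoryTailL` (stmt-QuantumFields-19936), LINE 25 «CompactnessTransfer»,
# the (TM) road, ROAD (H) «SU(2) CURRENTS ⇒ H-SYSTEM ⇒ 8π QUANTUM» — brick (K), the (H)-door DISCHARGED: «(GAP) ⟸ (F) ∧ (T)-door»

Cell `ym3-torus` (YM ladder rung R3 = continuum SU(2) Yang–Mills on T³ — a RUNG, NOT Clay: not d = 4, not infinite volume,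
not a mass gap); WIDTH helper seat `ym3-torus-px19` g8; `--supports stmt-QuantumFields-23533`; THEOREMS ONLY (0 `def`, 0 `sorry`,
default heartbeats); imports this seat's ✓(K-DOOR) `…GapOfHSystemQuantization` and px5 g9's ✓H5 `…PlanarStreamFunctionBundle`
(★★`doorH` — the planar stream function, `E³` bundle, whose TYPE is the (H)-door text verbatim).

WHAT THIS FILE PROVES.  ★★★ `gap_of_hSystemQuantization_of_transport (hF) (hT) : ⟨(GAP)⟩` — px3 g9's frozen (GAP) binder text
(sha16 30a3f4556be5a68a) from the named printed fact `Literature.Analysis.PDE.HSystemEnergyQuantization` [BrezisCoron1985, Lemma A.1]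
and the ONE remaining door (T) «cone → plane transport» (px14 g7 ∕ px16 g10, `exists_link_of_linear_energies`, typing): the (H)-door of
✓`gap_of_hSystemQuantization_of_doors` is discharged BY NAME by ✓`PoincareLipschitzPlanarStreamFunctionBundle.doorH`.
HONEST SCOPE.  Conditional on (F) (named printed fact) and (T) (hypothesis); (GAP)∕(TM), S1″, K1, `MeanDeviationL`, `BlockLipschitzL`,
`HistoryTailL` NOT proved.  YM₃ on T³ is rung R3, not Clay; YM gap NOT proved; no summit statement is proved here.

References: H. Brezis, J.-M. Coron, Arch. Rational Mech. Anal. 89 (1985) [BrezisCoron1985] (Appendix, Lemma A.1 = Lemma 0.1);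
R. Schoen, K. Uhlenbeck, Invent. Math. 78 (1984) [SchoenUhlenbeck1984] (Lemma 1.1, Prop. 1.2).
-/

set_option autoImplicit false

noncomputable section

open MeasureTheory Set Function Filter Topology Metric TopologicalSpace
open scoped ContDiff ENNReal BigOperators RealInnerProductSpace

namespace Summit.QuantumFields.YangMills.Theorems.PoincareLipschitzGapOfHSystemQuantizationOfTransport

open Literature.Analysis.FunctionSpaces
open Summit.QuantumFields.YangMills.Theorems.PoincareLipschitzGapOfHSystemQuantization (gap_of_hSystemQuantization_of_doors)

/-- ★★★ **THE `8π` GAP FROM THE H-SYSTEM QUANTUM, (H)-DOOR DISCHARGED**: (GAP) ⟸ `HSystemEnergyQuantization` ∧ (T)-door, the planar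
stream functions being px5 g9's ✓`PoincareLipschitzPlanarStreamFunctionBundle.doorH`. [cite: BrezisCoron1985, Appendix, Lemma A.1; SchoenUhlenbeck1984, Proposition 1.2] -/
theorem gap_of_hSystemQuantization_of_transport (hF : Literature.Analysis.PDE.HSystemEnergyQuantization)
    (hT : ∀ (hQ : IsOpen {x : EuclideanSpace ℝ (Fin 3) | ∀ i : Fin 3, |x i| < 1}) (U : EuclideanSpace ℝ (Fin 3) → EuclideanSpace ℝ (Fin 4)) (G : EuclideanSpace ℝ (Fin 3) → (EuclideanSpace ℝ (Fin 3) →L[ℝ] EuclideanSpace ℝ (Fin 4))),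
      (HasWeakFDerivOn ⟨{x : EuclideanSpace ℝ (Fin 3) | ∀ i : Fin 3, |x i| < 1}, hQ⟩ volume U G ∧
        (∀ x : EuclideanSpace ℝ (Fin 3), (∀ i : Fin 3, |x i| < 1) → ‖U x‖ = 1) ∧
        IntegrableOn (fun x => ∑ i : Fin 3, ‖G x (EuclideanSpace.single i (1:ℝ))‖ ^ 2) {x : EuclideanSpace ℝ (Fin 3) | ∀ i : Fin 3, |x i| < 1} ∧
        (∀ (y : EuclideanSpace ℝ (Fin 3)) (ρ : ℝ), 0 < ρ → closedBall y ρ ⊆ {x : EuclideanSpace ℝ (Fin 3) | ∀ i : Fin 3, |x i| < 1} →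
          ∀ (W : EuclideanSpace ℝ (Fin 3) → EuclideanSpace ℝ (Fin 4)) (GW : EuclideanSpace ℝ (Fin 3) → (EuclideanSpace ℝ (Fin 3) →L[ℝ] EuclideanSpace ℝ (Fin 4))),
          HasWeakFDerivOn ⟨{x : EuclideanSpace ℝ (Fin 3) | ∀ i : Fin 3, |x i| < 1}, hQ⟩ volume W GW →
          (∀ x : EuclideanSpace ℝ (Fin 3), (∀ i : Fin 3, |x i| < 1) → ‖W x‖ = 1) →
          IntegrableOn (fun x => ∑ i : Fin 3, ‖GW x (EuclideanSpace.single i (1:ℝ))‖ ^ 2) {x : EuclideanSpace ℝ (Fin 3) | ∀ i : Fin 3, |x i| < 1} →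
          (∃ ρ' : ℝ, ρ' < ρ ∧ ∀ x : EuclideanSpace ℝ (Fin 3), x ∉ ball y ρ' → W x = U x) →
          ∫ x in ball y ρ, ∑ i : Fin 3, ‖G x (EuclideanSpace.single i (1:ℝ))‖ ^ 2 ≤ ∫ x in ball y ρ, ∑ i : Fin 3, ‖GW x (EuclideanSpace.single i (1:ℝ))‖ ^ 2)) →
      ∀ Θ : ℝ, (∀ r : ℝ, 0 < r → r ≤ 1 / 2 → ∫ x in ball (0 : EuclideanSpace ℝ (Fin 3)) r, ∑ i : Fin 3, ‖G x (EuclideanSpace.single i (1:ℝ))‖ ^ 2 = Θ * r) →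
      ∃ (w : EuclideanSpace ℝ (Fin 2) → EuclideanSpace ℝ (Fin 4)) (Gw : EuclideanSpace ℝ (Fin 2) → (EuclideanSpace ℝ (Fin 2) →L[ℝ] EuclideanSpace ℝ (Fin 4))),
        HasWeakFDerivOn ⟨Set.univ, isOpen_univ⟩ volume w Gw ∧ (∀ y, ‖w y‖ = 1) ∧
        Integrable (fun y => ∑ k : Fin 2, ‖Gw y (EuclideanSpace.single k (1:ℝ))‖ ^ 2) volume ∧
        (∫ y, ∑ k : Fin 2, ‖Gw y (EuclideanSpace.single k (1:ℝ))‖ ^ 2 = Θ) ∧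
        (∀ (p q : EuclideanSpace ℝ (Fin 4)), ‖p‖ = 1 → ‖q‖ = 1 → ⟪p, q⟫ = 0 →
          ∀ η : EuclideanSpace ℝ (Fin 2) → ℝ, ContDiff ℝ ∞ η → HasCompactSupport η →
            ∫ y, ∑ k : Fin 2, fderiv ℝ η y (EuclideanSpace.single k (1:ℝ)) *
              (⟪p, w y⟫ * ⟪Gw y (EuclideanSpace.single k (1:ℝ)), q⟫ - ⟪q, w y⟫ * ⟪Gw y (EuclideanSpace.single k (1:ℝ)), p⟫) = 0)) :
    ∀ (hQ : IsOpen {x : EuclideanSpace ℝ (Fin 3) | ∀ i : Fin 3, |x i| < 1}) (U : EuclideanSpace ℝ (Fin 3) → EuclideanSpace ℝ (Fin 4)) (G : EuclideanSpace ℝ (Fin 3) → (EuclideanSpace ℝ (Fin 3) →L[ℝ] EuclideanSpace ℝ (Fin 4))),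
      (HasWeakFDerivOn ⟨{x : EuclideanSpace ℝ (Fin 3) | ∀ i : Fin 3, |x i| < 1}, hQ⟩ volume U G ∧
        (∀ x : EuclideanSpace ℝ (Fin 3), (∀ i : Fin 3, |x i| < 1) → ‖U x‖ = 1) ∧
        IntegrableOn (fun x => ∑ i : Fin 3, ‖G x (EuclideanSpace.single i (1:ℝ))‖ ^ 2) {x : EuclideanSpace ℝ (Fin 3) | ∀ i : Fin 3, |x i| < 1} ∧
        (∀ (y : EuclideanSpace ℝ (Fin 3)) (ρ : ℝ), 0 < ρ → closedBall y ρ ⊆ {x : EuclideanSpace ℝ (Fin 3) | ∀ i : Fin 3, |x i| < 1} →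
          ∀ (W : EuclideanSpace ℝ (Fin 3) → EuclideanSpace ℝ (Fin 4)) (GW : EuclideanSpace ℝ (Fin 3) → (EuclideanSpace ℝ (Fin 3) →L[ℝ] EuclideanSpace ℝ (Fin 4))),
          HasWeakFDerivOn ⟨{x : EuclideanSpace ℝ (Fin 3) | ∀ i : Fin 3, |x i| < 1}, hQ⟩ volume W GW →
          (∀ x : EuclideanSpace ℝ (Fin 3), (∀ i : Fin 3, |x i| < 1) → ‖W x‖ = 1) →
          IntegrableOn (fun x => ∑ i : Fin 3, ‖GW x (EuclideanSpace.single i (1:ℝ))‖ ^ 2) {x : EuclideanSpace ℝ (Fin 3) | ∀ i : Fin 3, |x i| < 1} →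
          (∃ ρ' : ℝ, ρ' < ρ ∧ ∀ x : EuclideanSpace ℝ (Fin 3), x ∉ ball y ρ' → W x = U x) →
          ∫ x in ball y ρ, ∑ i : Fin 3, ‖G x (EuclideanSpace.single i (1:ℝ))‖ ^ 2 ≤ ∫ x in ball y ρ, ∑ i : Fin 3, ‖GW x (EuclideanSpace.single i (1:ℝ))‖ ^ 2)) →
      ∀ Θ : ℝ, (∀ r : ℝ, 0 < r → r ≤ 1 / 2 → ∫ x in ball (0 : EuclideanSpace ℝ (Fin 3)) r, ∑ i : Fin 3, ‖G x (EuclideanSpace.single i (1:ℝ))‖ ^ 2 = Θ * r) →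
        Θ ≤ 3 * Real.pi → Θ = 0 :=
  gap_of_hSystemQuantization_of_doors hF hT
    Summit.QuantumFields.YangMills.Theorems.PoincareLipschitzPlanarStreamFunctionBundle.doorH

end Summit.QuantumFields.YangMills.Theorems.PoincareLipschitzGapOfHSystemQuantizationOfTransport
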